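import Summits.QuantumFields.BalabanUV.Beta.GAN24.CombFaceWordCellPairing
import Summits.QuantumFields.BalabanUV.Beta.GAN24.CombFaceWordEEValueDeep
import Summits.QuantumFields.BalabanUV.Beta.GAN24.CombForcingTransport
import Summits.QuantumFields.BalabanUV.Beta.GAN24.CombRespWordsZero
import Summits.QuantumFields.BalabanUV.Beta.GAN24.FaceReadCrossedFromValues
import Summits.QuantumFields.BalabanUV.Beta.GAN24.FaceWordSwapGeneric
import Summits.QuantumFields.BalabanUV.Beta.GAN24.FaceWWordLetters

/-!
# G-an2-4, `hXF(l+1)` lane — the crossed period-`P` face read of the COMB forcing table at the deep levels `k+1`, VALUED (`d`-generic)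

NOT IN PRINT; OUR BOOKKEEPING (Balaban never evaluates a renormalisation-group face read in closed form; the objects are ours).

This is the comb-data twin of leaf-06's `FaceReadCrossedValueDeep.crossed_faceRead_dressedStep_deep`: the SAME right-hand side (the two cell-pairing values of
`CombFaceWordEEValueDeep`, which are leaf-06's `FaceWordEEValueDeep` values token for token), but the forcing on the left is road-P2's comb forcing table
`c • mmRead Lc (K3OfK (unitK sf sm (GcombSh Lc (j+1))) Lc (unitS sf sm (SpureCombOf (symTablesAn1S2 d Lc cΛt) cE cVH cΛ (j+1))) (unitM sf sm (tabs.M (j+1))) (W2SymOfK …)) + cB • B`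
at the Ward pins `cE = Lc^(d+1)`, `cVH = -(Lc^(d+1)·½·Lc^(d+1))`, for ANY border `B` vanishing on the fine-fine block and ANY `a₀ ≠ b₀`.

## Proof (no new estimate)
* g85 F1 `CombForcingTransport.combForcingTable_eq_bm_transport`: the comb forcing table IS the bm-kernel functional `K3OfK (unitK (coDressKBmAt ρ_c Lc (KInvStep Lc (j+1))))`
  evaluated on the `Ψ̂`-TRANSPORTED tables `𝒯S̃′`, `𝒯M`, `𝒯M₂`;
* leaf-06's generic adapter `FaceReadCrossedFromValues.crossed_faceRead_of_values` at the root offset `ctrOff (d+1) Lc` with `S := 𝒯S̃′_{j+1}`, `M := 𝒯M_{j+1}`,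
  `M₂ := 𝒯M₂_{j+1}` (sockets: F2 `CombForcingTwoFaceWords.exists_*_transport_*`, F5 `CombWWordZero.transport*_translate`, parity-oddness of the transported
  rows from F4 `CombRespWordsZero.parityOdd_transportS` ∕ road-P2 `CombTransportParity.parityOdd_conj_psiKS` + an1 `trK_M1Of_symHessFFAt`);
* the eight fine-word values: §1 below = D2 `CombFaceWordCellPairing.faceWord_comb_succ_eq_cellPairing` (transported fine word = cell pairing of the
  UNTRANSPORTED cubic-sector currents) ⨾ C `CombFaceWordEEValueDeep` (value ∕ left-diagonal zero) ⨾ K4a `FaceWordSwapGeneric.swapWord_eq_directWord`.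

## Main results
* `combWord_deep_value`, `combWord_deep_eq_zero_of_left_diag`, `combSwapWord_deep_value`, `combSwapWord_deep_eq_zero_of_left_diag` (§1: the four patterns);
* `transported_rows_parityOdd_S`, `transported_rows_parityOdd_M` (§2: the parity sockets);
* `crossed_faceRead_comb_deep` (§3: the valued crossed face read — the `hface (k+1)` datum of F52
  `CombChartCrossedLedgerForcingCell.crossedConserved_iff_cellLaw_of_levelZeroValue_wilson_pin` before the `d = 3` pin `FaceReadCrossedValueDeepPin.pin_deep_crossed`).
-/

noncomputable section

open Finset
open scoped BigOperators
open Literature.MathematicalPhysics.QuantumFieldTheory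
open Literature.MathematicalPhysics.QuantumFieldTheory.Balaban1983to89
open Literature.MathematicalPhysics.QuantumFieldTheory.Balaban1983to89.Beta
open ExpKernelCalculus (Site MKer Decays BiLoc VertexFamily shiftK comp)
open OneStepResolventKernel (Fib LocStencil decays_mono)
open OneStepKernelFamily (KInvStep shiftK_KInvStep)
open BalabanStepJets (locStencil_mono)
open AffineAveraging (box toSite)
open AveragingContoursRooted (ctr ctrOff ctrOff_mem_box)
open SecondOrderResponse (W2SymOfK LocStencilFM)
open BalabanStepJetsSucc (mmRead E2 wVH wE)
open BalabanStepW2 (K3OfK M2Of)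
open Summit.QuantumFields.BalabanUV.Beta.TameKernelCalculus (Loc trK)
open Summit.QuantumFields.BalabanUV.Beta.BorderedHessian (stepScale sgnK)
open Summit.QuantumFields.BalabanUV.Beta.AxialDressingRooted (coDressKBmAt decays_coDressKBmAt_KInvStep shiftK_coDressKBmAt one_le_of_neZero)
open Summit.QuantumFields.BalabanUV.Beta.HessKerDressedUnits (unitK unitS decays_unitK)
open Summit.QuantumFields.BalabanUV.Beta.SecondOrderUnits (unitM unitM₂)
open Summit.QuantumFields.BalabanUV.Beta.SymmetrisedStepJets (SymTables)
open Summit.QuantumFields.BalabanUV.Beta.SymSecondOrderTablesAn1 (symTablesAn1S2)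
open Summit.QuantumFields.BalabanUV.Beta.SymTablesAn1FirstOrder (trK_M1Of_symHessFFAt)
open Summit.QuantumFields.BalabanUV.Beta.CombChartStepJets (GcombSh SpureCombOf)
open Summit.QuantumFields.BalabanUV.Beta.SymCorrectorKernel (psiKS spr_psiKS)
open Summit.QuantumFields.BalabanUV.Beta.SymCorrectorFace (slotPsiS)
open Summit.QuantumFields.BalabanUV.Beta.GAN24.BiStencilZeroMode (Tab)
open Summit.QuantumFields.BalabanUV.Beta.GAN24.CombTransportParity (parityOdd_conj_psiKS)
open Summit.QuantumFields.BalabanUV.Beta.GAN24.CombTransportedBorder (transport_unitS)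
open Summit.QuantumFields.BalabanUV.Beta.GAN24.FaceWWordLetters (trK_unitS_of_rows)
open Summit.QuantumFields.BalabanUV.Beta.GAN24.CombRespWordsZero (parityOdd_transportS)
open Summit.QuantumFields.BalabanUV.Beta.GAN24.CombForcingPairForm (exists_vertexFamily_unitM_tabs trK_unitM_tabs)
open Summit.QuantumFields.BalabanUV.Beta.GAN24.CombForcingTwoFaceWords (exists_locStencil_transport_S exists_vertexFamily_transport_M exists_locStencilFM_transport_M₂)
open Summit.QuantumFields.BalabanUV.Beta.GAN24.CombWWordZero (transportS_unitS_translate transportM_translate transportM₂_translate)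
open Summit.QuantumFields.BalabanUV.Beta.GAN24.CombForcingTransport (combForcingTable_eq_bm_transport)
open Summit.QuantumFields.BalabanUV.Beta.GAN24.FaceReadCrossedFromValues (crossed_faceRead_of_values)
open Summit.QuantumFields.BalabanUV.Beta.GAN24.FaceWordSwapGeneric (swapWord_eq_directWord)
open Summit.QuantumFields.BalabanUV.Beta.GAN24.CombFaceWordCellPairing (faceWord_comb_succ_eq_cellPairing)
open Summit.QuantumFields.BalabanUV.Beta.GAN24.CombFaceWordEEValueDeep (cellPairing_deep_value_units cellPairing_deep_eq_zero_of_left_diag_units)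

namespace Summit.QuantumFields.BalabanUV.Beta.GAN24.CombFaceReadCrossedValueDeep

variable {d : ℕ} {Lc : ℕ} [NeZero Lc]

/-! ## §0 Sockets (every level `i`): one common rate for `(𝒯S̃′_i, X̃_i)` and the period-`Lc·N` covariance ∕ invariance -/

/-- NOT IN PRINT; OUR BOOKKEEPING.  One common rate (every level `i`): the transported dressed comb table `𝒯S̃′_i` is a `LocStencil` and the dressed bm step
kernel `X̃_i` `Decays`, at ONE rate `m > 0`. -/
theorem exists_common_rate_comb (cΛt sf sm cE cVH cΛ : ℝ) (i : ℕ) :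
    ∃ Cs CX m : ℝ, 0 < m ∧ LocStencil (fun κ u => comp (comp (trK (psiKS (ctrOff (d + 1) Lc) Lc)) (slotPsiS (ctrOff (d + 1) Lc) Lc (unitS sf sm (SpureCombOf (symTablesAn1S2 d Lc cΛt) cE cVH cΛ i)) κ u)) (psiKS (ctrOff (d + 1) Lc) Lc)) Cs m
      ∧ Decays (unitK sf sm (coDressKBmAt (toSite (ctrOff (d + 1) Lc)) Lc (KInvStep (d := d) Lc i))) CX m := by
  have hLc : 0 < Lc := Nat.pos_of_ne_zero (NeZero.ne Lc)
  obtain ⟨Cs, δs, hδs, hS⟩ := exists_locStencil_transport_S (symTablesAn1S2 d Lc cΛt) sf sm cE cVH cΛ i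
  obtain ⟨δK, CK, hδK, -, hG⟩ := decays_coDressKBmAt_KInvStep (d := d) (Lc := Lc) (ctrOff_mem_box hLc) i
  have hXu := decays_unitK (sf := sf) (sm := sm) hG
  refine ⟨Cs, _, min δs δK, lt_min hδs hδK, locStencil_mono hS ((hS 0 0).nonneg (Sum.inl 0)) (min_le_left _ _),
    decays_mono hXu (hXu.nonneg (Sum.inl 0)) le_rfl (min_le_right _ _)⟩

/-- NOT IN PRINT; OUR BOOKKEEPING.  Period-`Lc·N` covariance of the transported dressed comb table (F5 `transportS_unitS_translate` at `t := N•s`). -/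
theorem transportS_translateN (cΛt sf sm cE cVH cΛ : ℝ) (i N : ℕ) (κ : Fin (d + 1)) (t s : Site (d + 1)) :
    (fun κ u => comp (comp (trK (psiKS (ctrOff (d + 1) Lc) Lc)) (slotPsiS (ctrOff (d + 1) Lc) Lc (unitS sf sm (SpureCombOf (symTablesAn1S2 d Lc cΛt) cE cVH cΛ i)) κ u)) (psiKS (ctrOff (d + 1) Lc) Lc)) κ (t + ((Lc * N : ℕ) : ℤ) • s)
      = shiftK (-(((Lc * N : ℕ) : ℤ) • s)) ((fun κ u => comp (comp (trK (psiKS (ctrOff (d + 1) Lc) Lc)) (slotPsiS (ctrOff (d + 1) Lc) Lc (unitS sf sm (SpureCombOf (symTablesAn1S2 d Lc cΛt) cE cVH cΛ i)) κ u)) (psiKS (ctrOff (d + 1) Lc) Lc)) κ t) := by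
  have esmul : ((Lc * N : ℕ) : ℤ) • s = (Lc : ℤ) • ((N : ℤ) • s) := by rw [smul_smul, Nat.cast_mul]
  rw [esmul]
  exact transportS_unitS_translate (symTablesAn1S2 d Lc cΛt) sf sm cE cVH cΛ i κ t ((N : ℤ) • s)

/-- NOT IN PRINT; OUR BOOKKEEPING.  Period-`Lc·N` invariance of the dressed bm step kernel `X̃_i` (`shiftK_coDressKBmAt` + `shiftK_KInvStep`). -/
theorem bmKernel_invariantN (sf sm : ℝ) (i N : ℕ) (s : Site (d + 1)) :
    shiftK (-(((Lc * N : ℕ) : ℤ) • s)) (unitK sf sm (coDressKBmAt (toSite (ctrOff (d + 1) Lc)) Lc (KInvStep (d := d) Lc i))) = unitK sf sm (coDressKBmAt (toSite (ctrOff (d + 1) Lc)) Lc (KInvStep (d := d) Lc i)) := by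
  have hLc1 : 1 ≤ Lc := one_le_of_neZero Lc
  have esmul : ((Lc * N : ℕ) : ℤ) • s = (Lc : ℤ) • ((N : ℤ) • s) := by rw [smul_smul, Nat.cast_mul]
  rw [esmul]
  show unitK sf sm (shiftK (-((Lc : ℤ) • ((N : ℤ) • s))) (coDressKBmAt (toSite (ctrOff (d + 1) Lc)) Lc (KInvStep (d := d) Lc i))) = _
  rw [shiftK_coDressKBmAt (toSite (ctrOff (d + 1) Lc)) hLc1 (shiftK_KInvStep (d := d) (Lc := Lc) i) ((N : ℤ) • s)]

/-! ## §1 The four fine-word patterns of `(𝒯S̃′_{j+1}, X̃_{j+1})` at the Ward pins, period `Lc·N` -/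

/-- NOT IN PRINT; OUR BOOKKEEPING.  **THE DIRECT EXCHANGE FACE WORD OF THE TRANSPORTED COMB TABLE, VALUED** (`μ ≠ α`, `ν ≠ β`): D2 `faceWord_comb_succ_eq_cellPairing` then
C `cellPairing_deep_value_units`; the right-hand side is leaf-06's `FaceWordFullDeep.faceWordFull_deep_value` right-hand side token for token. -/
theorem combWord_deep_value (cΛt sf sm cΛ : ℝ) (j N : ℕ) [NeZero N] {μ α ν β : Fin (d + 1)} (hμα : μ ≠ α) (hνβ : ν ≠ β) :
    ∑ rr ∈ box (d + 1) (Lc * N), ∑' t : Site (d + 1),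
        (if toSite rr μ % ((Lc * N : ℕ) : ℤ) = ((Lc * N : ℕ) : ℤ) - 1 then (1 : ℝ) else 0) * (if t ν % ((Lc * N : ℕ) : ℤ) = ((Lc * N : ℕ) : ℤ) - 1 then (1 : ℝ) else 0) *
        ∑' yw : Site (d + 1) × Site (d + 1),
          (if yw.1 α % ((Lc * N : ℕ) : ℤ) = ((Lc * N : ℕ) : ℤ) - 1 then (1 : ℝ) else 0) * (if yw.2 β % ((Lc * N : ℕ) : ℤ) = ((Lc * N : ℕ) : ℤ) - 1 then (1 : ℝ) else 0) *
          comp (comp ((fun κ u => comp (comp (trK (psiKS (ctrOff (d + 1) Lc) Lc)) (slotPsiS (ctrOff (d + 1) Lc) Lc (unitS sf sm (SpureCombOf (symTablesAn1S2 d Lc cΛt) ((Lc : ℝ) ^ (d + 1)) (-((Lc : ℝ) ^ (d + 1) * (1 / 2) * (Lc : ℝ) ^ (d + 1))) cΛ (j + 1))) κ u)) (psiKS (ctrOff (d + 1) Lc) Lc)) μ (toSite rr))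
            (unitK sf sm (coDressKBmAt (toSite (ctrOff (d + 1) Lc)) Lc (KInvStep (d := d) Lc (j + 1)))))
            ((fun κ u => comp (comp (trK (psiKS (ctrOff (d + 1) Lc) Lc)) (slotPsiS (ctrOff (d + 1) Lc) Lc (unitS sf sm (SpureCombOf (symTablesAn1S2 d Lc cΛt) ((Lc : ℝ) ^ (d + 1)) (-((Lc : ℝ) ^ (d + 1) * (1 / 2) * (Lc : ℝ) ^ (d + 1))) cΛ (j + 1))) κ u)) (psiKS (ctrOff (d + 1) Lc) Lc)) ν t)
            yw.1 yw.2 (Sum.inl α) (Sum.inl β) =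
      (((sf * sm)⁻¹ * (sf⁻¹ * sf⁻¹) * ((Lc : ℝ) ^ (d + 1) * wE d Lc (j + 1))) * ((sf * sm)⁻¹ * (sf⁻¹ * sf⁻¹) * ((Lc : ℝ) ^ (d + 1) * wE d Lc (j + 1)))) *
      ((-(1 / 2 : ℝ)) * (1 / 2 : ℝ) * ((sf * sf) *
        ((wVH d Lc (j + 1))⁻¹ *
            ∑ x ∈ box (d + 1) (Lc * N), ∑ b : Fin (d + 1),
              ((if b = μ then ((((Lc * N : ℕ) : ℝ))⁻¹ * (((Lc * N : ℕ) : ℝ))⁻¹) * ((((toSite x α % ((Lc * N : ℕ) : ℤ) : ℤ) : ℝ) - ((((Lc * N : ℕ) : ℝ)) - 1) / 2)) else 0)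
                + (if b = α then (-(((Lc * N : ℕ) : ℝ))⁻¹ * ((((toSite x μ % ((Lc * N : ℕ) : ℤ) : ℤ) : ℝ) - ((((Lc * N : ℕ) : ℝ)) - 1) / 2))) *
                    (if toSite x α % ((Lc * N : ℕ) : ℤ) = ((Lc * N : ℕ) : ℤ) - 1 then (1 : ℝ) else 0) else 0)) *
              ∑' s : Site (d + 1), ∑ b' : Fin (d + 1), E2 d Lc (j + 1) (toSite x) s (Sum.inl b) (Sum.inl b') *
                ((if b' = ν then ((((Lc * N : ℕ) : ℝ))⁻¹ * (((Lc * N : ℕ) : ℝ))⁻¹) * ((((s β % ((Lc * N : ℕ) : ℤ) : ℤ) : ℝ) - ((((Lc * N : ℕ) : ℝ)) - 1) / 2)) else 0)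
                  + (if b' = β then (-(((Lc * N : ℕ) : ℝ))⁻¹ * ((((s ν % ((Lc * N : ℕ) : ℤ) : ℤ) : ℝ) - ((((Lc * N : ℕ) : ℝ)) - 1) / 2))) *
                      (if s β % ((Lc * N : ℕ) : ℤ) = ((Lc * N : ℕ) : ℤ) - 1 then (1 : ℝ) else 0) else 0)) -
          (wVH d Lc (j + 1))⁻¹ * (((Lc : ℝ) ^ (d + 1) * (Lc : ℝ) ^ (d + 1)) *
            ∑ y ∈ box (d + 1) N, ∑ a : Fin (d + 1),
              ((if a = μ then (((N : ℝ))⁻¹ * ((N : ℝ))⁻¹) * ((((toSite y α % (N : ℤ)) : ℤ) : ℝ) - ((N : ℝ) - 1) / 2) else 0)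
                + (if a = α then (-((N : ℝ))⁻¹ * ((((toSite y μ % (N : ℤ)) : ℤ) : ℝ) - ((N : ℝ) - 1) / 2)) *
                    (if toSite y α % (N : ℤ) = (N : ℤ) - 1 then (1 : ℝ) else 0) else 0)) *
              ∑' s : Site (d + 1), ∑ b' : Fin (d + 1), E2 d Lc (j + 2) (toSite y) s (Sum.inl a) (Sum.inl b') *
                ((if b' = ν then (((N : ℝ))⁻¹ * ((N : ℝ))⁻¹) * ((((s β % (N : ℤ)) : ℤ) : ℝ) - ((N : ℝ) - 1) / 2) else 0)
                  + (if b' = β then (-((N : ℝ))⁻¹ * ((((s ν % (N : ℤ)) : ℤ) : ℝ) - ((N : ℝ) - 1) / 2)) *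
                      (if s β % (N : ℤ) = (N : ℤ) - 1 then (1 : ℝ) else 0) else 0)))))) := by
  rw [faceWord_comb_succ_eq_cellPairing cΛt sf sm ((Lc : ℝ) ^ (d + 1)) (-((Lc : ℝ) ^ (d + 1) * (1 / 2) * (Lc : ℝ) ^ (d + 1))) cΛ j N μ ν α β]
  exact cellPairing_deep_value_units cΛt sf sm ((Lc : ℝ) ^ (d + 1) * wE d Lc (j + 1)) cΛ j N hμα hνβ

/-- NOT IN PRINT; OUR BOOKKEEPING.  **LEFT DIAGONAL (`α = μ`): the direct exchange face word of the transported comb table is `0`.** -/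
theorem combWord_deep_eq_zero_of_left_diag (cΛt sf sm cΛ : ℝ) (j N : ℕ) [NeZero N] (μ ν β : Fin (d + 1)) :
    ∑ rr ∈ box (d + 1) (Lc * N), ∑' t : Site (d + 1),
        (if toSite rr μ % ((Lc * N : ℕ) : ℤ) = ((Lc * N : ℕ) : ℤ) - 1 then (1 : ℝ) else 0) * (if t ν % ((Lc * N : ℕ) : ℤ) = ((Lc * N : ℕ) : ℤ) - 1 then (1 : ℝ) else 0) *
        ∑' yw : Site (d + 1) × Site (d + 1),
          (if yw.1 μ % ((Lc * N : ℕ) : ℤ) = ((Lc * N : ℕ) : ℤ) - 1 then (1 : ℝ) else 0) * (if yw.2 β % ((Lc * N : ℕ) : ℤ) = ((Lc * N : ℕ) : ℤ) - 1 then (1 : ℝ) else 0) *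
          comp (comp ((fun κ u => comp (comp (trK (psiKS (ctrOff (d + 1) Lc) Lc)) (slotPsiS (ctrOff (d + 1) Lc) Lc (unitS sf sm (SpureCombOf (symTablesAn1S2 d Lc cΛt) ((Lc : ℝ) ^ (d + 1)) (-((Lc : ℝ) ^ (d + 1) * (1 / 2) * (Lc : ℝ) ^ (d + 1))) cΛ (j + 1))) κ u)) (psiKS (ctrOff (d + 1) Lc) Lc)) μ (toSite rr))
            (unitK sf sm (coDressKBmAt (toSite (ctrOff (d + 1) Lc)) Lc (KInvStep (d := d) Lc (j + 1)))))
            ((fun κ u => comp (comp (trK (psiKS (ctrOff (d + 1) Lc) Lc)) (slotPsiS (ctrOff (d + 1) Lc) Lc (unitS sf sm (SpureCombOf (symTablesAn1S2 d Lc cΛt) ((Lc : ℝ) ^ (d + 1)) (-((Lc : ℝ) ^ (d + 1) * (1 / 2) * (Lc : ℝ) ^ (d + 1))) cΛ (j + 1))) κ u)) (psiKS (ctrOff (d + 1) Lc) Lc)) ν t)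
            yw.1 yw.2 (Sum.inl μ) (Sum.inl β) = 0 := by
  rw [faceWord_comb_succ_eq_cellPairing cΛt sf sm ((Lc : ℝ) ^ (d + 1)) (-((Lc : ℝ) ^ (d + 1) * (1 / 2) * (Lc : ℝ) ^ (d + 1))) cΛ j N μ ν μ β]
  exact cellPairing_deep_eq_zero_of_left_diag_units cΛt sf sm ((Lc : ℝ) ^ (d + 1) * wE d Lc (j + 1)) cΛ j N μ ν β

/-- NOT IN PRINT; OUR BOOKKEEPING.  **THE SWAPPED EXCHANGE FACE WORD OF THE TRANSPORTED COMB TABLE, VALUED** (`ν ≠ α`, `μ ≠ β`): K4a's bond swap then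
`combWord_deep_value` with the bond directions exchanged. -/
theorem combSwapWord_deep_value (cΛt sf sm cΛ : ℝ) (j N : ℕ) [NeZero N] {μ α ν β : Fin (d + 1)} (hνα : ν ≠ α) (hμβ : μ ≠ β) :
    ∑ rr ∈ box (d + 1) (Lc * N), ∑' t : Site (d + 1),
        (if toSite rr μ % ((Lc * N : ℕ) : ℤ) = ((Lc * N : ℕ) : ℤ) - 1 then (1 : ℝ) else 0) * (if t ν % ((Lc * N : ℕ) : ℤ) = ((Lc * N : ℕ) : ℤ) - 1 then (1 : ℝ) else 0) *
        ∑' yw : Site (d + 1) × Site (d + 1),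
          (if yw.1 α % ((Lc * N : ℕ) : ℤ) = ((Lc * N : ℕ) : ℤ) - 1 then (1 : ℝ) else 0) * (if yw.2 β % ((Lc * N : ℕ) : ℤ) = ((Lc * N : ℕ) : ℤ) - 1 then (1 : ℝ) else 0) *
          comp (comp ((fun κ u => comp (comp (trK (psiKS (ctrOff (d + 1) Lc) Lc)) (slotPsiS (ctrOff (d + 1) Lc) Lc (unitS sf sm (SpureCombOf (symTablesAn1S2 d Lc cΛt) ((Lc : ℝ) ^ (d + 1)) (-((Lc : ℝ) ^ (d + 1) * (1 / 2) * (Lc : ℝ) ^ (d + 1))) cΛ (j + 1))) κ u)) (psiKS (ctrOff (d + 1) Lc) Lc)) ν t)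
            (unitK sf sm (coDressKBmAt (toSite (ctrOff (d + 1) Lc)) Lc (KInvStep (d := d) Lc (j + 1)))))
            ((fun κ u => comp (comp (trK (psiKS (ctrOff (d + 1) Lc) Lc)) (slotPsiS (ctrOff (d + 1) Lc) Lc (unitS sf sm (SpureCombOf (symTablesAn1S2 d Lc cΛt) ((Lc : ℝ) ^ (d + 1)) (-((Lc : ℝ) ^ (d + 1) * (1 / 2) * (Lc : ℝ) ^ (d + 1))) cΛ (j + 1))) κ u)) (psiKS (ctrOff (d + 1) Lc) Lc)) μ (toSite rr))
            yw.1 yw.2 (Sum.inl α) (Sum.inl β) =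
      (((sf * sm)⁻¹ * (sf⁻¹ * sf⁻¹) * ((Lc : ℝ) ^ (d + 1) * wE d Lc (j + 1))) * ((sf * sm)⁻¹ * (sf⁻¹ * sf⁻¹) * ((Lc : ℝ) ^ (d + 1) * wE d Lc (j + 1)))) *
      ((-(1 / 2 : ℝ)) * (1 / 2 : ℝ) * ((sf * sf) *
        ((wVH d Lc (j + 1))⁻¹ *
            ∑ x ∈ box (d + 1) (Lc * N), ∑ b : Fin (d + 1),
              ((if b = ν then ((((Lc * N : ℕ) : ℝ))⁻¹ * (((Lc * N : ℕ) : ℝ))⁻¹) * ((((toSite x α % ((Lc * N : ℕ) : ℤ) : ℤ) : ℝ) - ((((Lc * N : ℕ) : ℝ)) - 1) / 2)) else 0)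
                + (if b = α then (-(((Lc * N : ℕ) : ℝ))⁻¹ * ((((toSite x ν % ((Lc * N : ℕ) : ℤ) : ℤ) : ℝ) - ((((Lc * N : ℕ) : ℝ)) - 1) / 2))) *
                    (if toSite x α % ((Lc * N : ℕ) : ℤ) = ((Lc * N : ℕ) : ℤ) - 1 then (1 : ℝ) else 0) else 0)) *
              ∑' s : Site (d + 1), ∑ b' : Fin (d + 1), E2 d Lc (j + 1) (toSite x) s (Sum.inl b) (Sum.inl b') *
                ((if b' = μ then ((((Lc * N : ℕ) : ℝ))⁻¹ * (((Lc * N : ℕ) : ℝ))⁻¹) * ((((s β % ((Lc * N : ℕ) : ℤ) : ℤ) : ℝ) - ((((Lc * N : ℕ) : ℝ)) - 1) / 2)) else 0)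
                  + (if b' = β then (-(((Lc * N : ℕ) : ℝ))⁻¹ * ((((s μ % ((Lc * N : ℕ) : ℤ) : ℤ) : ℝ) - ((((Lc * N : ℕ) : ℝ)) - 1) / 2))) *
                      (if s β % ((Lc * N : ℕ) : ℤ) = ((Lc * N : ℕ) : ℤ) - 1 then (1 : ℝ) else 0) else 0)) -
          (wVH d Lc (j + 1))⁻¹ * (((Lc : ℝ) ^ (d + 1) * (Lc : ℝ) ^ (d + 1)) *
            ∑ y ∈ box (d + 1) N, ∑ a : Fin (d + 1),
              ((if a = ν then (((N : ℝ))⁻¹ * ((N : ℝ))⁻¹) * ((((toSite y α % (N : ℤ)) : ℤ) : ℝ) - ((N : ℝ) - 1) / 2) else 0)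
                + (if a = α then (-((N : ℝ))⁻¹ * ((((toSite y ν % (N : ℤ)) : ℤ) : ℝ) - ((N : ℝ) - 1) / 2)) *
                    (if toSite y α % (N : ℤ) = (N : ℤ) - 1 then (1 : ℝ) else 0) else 0)) *
              ∑' s : Site (d + 1), ∑ b' : Fin (d + 1), E2 d Lc (j + 2) (toSite y) s (Sum.inl a) (Sum.inl b') *
                ((if b' = μ then (((N : ℝ))⁻¹ * ((N : ℝ))⁻¹) * ((((s β % (N : ℤ)) : ℤ) : ℝ) - ((N : ℝ) - 1) / 2) else 0)
                  + (if b' = β then (-((N : ℝ))⁻¹ * ((((s μ % (N : ℤ)) : ℤ) : ℝ) - ((N : ℝ) - 1) / 2)) *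
                      (if s β % (N : ℤ) = (N : ℤ) - 1 then (1 : ℝ) else 0) else 0)))))) := by
  haveI : NeZero (Lc * N) := ⟨Nat.mul_ne_zero (NeZero.ne Lc) (NeZero.ne N)⟩
  obtain ⟨Cs, CX, m, hm, hS, hX⟩ := exists_common_rate_comb (d := d) (Lc := Lc) cΛt sf sm ((Lc : ℝ) ^ (d + 1)) (-((Lc : ℝ) ^ (d + 1) * (1 / 2) * (Lc : ℝ) ^ (d + 1))) cΛ (j + 1)
  rw [swapWord_eq_directWord (N := Lc * N) hS hX hm (fun κ t s => transportS_translateN cΛt sf sm ((Lc : ℝ) ^ (d + 1)) (-((Lc : ℝ) ^ (d + 1) * (1 / 2) * (Lc : ℝ) ^ (d + 1))) cΛ (j + 1) N κ t s) (fun s => bmKernel_invariantN (d := d) sf sm (j + 1) N s) μ ν α β,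
    faceWord_comb_succ_eq_cellPairing cΛt sf sm ((Lc : ℝ) ^ (d + 1)) (-((Lc : ℝ) ^ (d + 1) * (1 / 2) * (Lc : ℝ) ^ (d + 1))) cΛ j N ν μ α β]
  exact cellPairing_deep_value_units cΛt sf sm ((Lc : ℝ) ^ (d + 1) * wE d Lc (j + 1)) cΛ j N hνα hμβ

/-- NOT IN PRINT; OUR BOOKKEEPING.  **THE SWAPPED WORD VANISHES FOR `ν = α`** (its left current is diagonal). -/
theorem combSwapWord_deep_eq_zero_of_left_diag (cΛt sf sm cΛ : ℝ) (j N : ℕ) [NeZero N] (μ ν β : Fin (d + 1)) :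
    ∑ rr ∈ box (d + 1) (Lc * N), ∑' t : Site (d + 1),
        (if toSite rr μ % ((Lc * N : ℕ) : ℤ) = ((Lc * N : ℕ) : ℤ) - 1 then (1 : ℝ) else 0) * (if t ν % ((Lc * N : ℕ) : ℤ) = ((Lc * N : ℕ) : ℤ) - 1 then (1 : ℝ) else 0) *
        ∑' yw : Site (d + 1) × Site (d + 1),
          (if yw.1 ν % ((Lc * N : ℕ) : ℤ) = ((Lc * N : ℕ) : ℤ) - 1 then (1 : ℝ) else 0) * (if yw.2 β % ((Lc * N : ℕ) : ℤ) = ((Lc * N : ℕ) : ℤ) - 1 then (1 : ℝ) else 0) *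
          comp (comp ((fun κ u => comp (comp (trK (psiKS (ctrOff (d + 1) Lc) Lc)) (slotPsiS (ctrOff (d + 1) Lc) Lc (unitS sf sm (SpureCombOf (symTablesAn1S2 d Lc cΛt) ((Lc : ℝ) ^ (d + 1)) (-((Lc : ℝ) ^ (d + 1) * (1 / 2) * (Lc : ℝ) ^ (d + 1))) cΛ (j + 1))) κ u)) (psiKS (ctrOff (d + 1) Lc) Lc)) ν t)
            (unitK sf sm (coDressKBmAt (toSite (ctrOff (d + 1) Lc)) Lc (KInvStep (d := d) Lc (j + 1)))))
            ((fun κ u => comp (comp (trK (psiKS (ctrOff (d + 1) Lc) Lc)) (slotPsiS (ctrOff (d + 1) Lc) Lc (unitS sf sm (SpureCombOf (symTablesAn1S2 d Lc cΛt) ((Lc : ℝ) ^ (d + 1)) (-((Lc : ℝ) ^ (d + 1) * (1 / 2) * (Lc : ℝ) ^ (d + 1))) cΛ (j + 1))) κ u)) (psiKS (ctrOff (d + 1) Lc) Lc)) μ (toSite rr))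
            yw.1 yw.2 (Sum.inl ν) (Sum.inl β) = 0 := by
  haveI : NeZero (Lc * N) := ⟨Nat.mul_ne_zero (NeZero.ne Lc) (NeZero.ne N)⟩
  obtain ⟨Cs, CX, m, hm, hS, hX⟩ := exists_common_rate_comb (d := d) (Lc := Lc) cΛt sf sm ((Lc : ℝ) ^ (d + 1)) (-((Lc : ℝ) ^ (d + 1) * (1 / 2) * (Lc : ℝ) ^ (d + 1))) cΛ (j + 1)
  rw [swapWord_eq_directWord (N := Lc * N) hS hX hm (fun κ t s => transportS_translateN cΛt sf sm ((Lc : ℝ) ^ (d + 1)) (-((Lc : ℝ) ^ (d + 1) * (1 / 2) * (Lc : ℝ) ^ (d + 1))) cΛ (j + 1) N κ t s) (fun s => bmKernel_invariantN (d := d) sf sm (j + 1) N s) μ ν ν β,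
    faceWord_comb_succ_eq_cellPairing cΛt sf sm ((Lc : ℝ) ^ (d + 1)) (-((Lc : ℝ) ^ (d + 1) * (1 / 2) * (Lc : ℝ) ^ (d + 1))) cΛ j N ν μ ν β]
  exact cellPairing_deep_eq_zero_of_left_diag_units cΛt sf sm ((Lc : ℝ) ^ (d + 1) * wE d Lc (j + 1)) cΛ j N ν μ β

/-! ## §2 Parity-oddness of the transported rows (every level `i`) -/

/-- NOT IN PRINT; OUR BOOKKEEPING.  Every row of the transported dressed comb table is parity-odd (F4 `parityOdd_transportS` through the units). -/
theorem transported_rows_parityOdd_S (cΛt sf sm cE cVH cΛ : ℝ) (i : ℕ) (κ : Fin (d + 1)) (u : Site (d + 1)) :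
    trK ((fun κ u => comp (comp (trK (psiKS (ctrOff (d + 1) Lc) Lc)) (slotPsiS (ctrOff (d + 1) Lc) Lc (unitS sf sm (SpureCombOf (symTablesAn1S2 d Lc cΛt) cE cVH cΛ i)) κ u)) (psiKS (ctrOff (d + 1) Lc) Lc)) κ u)
      = -sgnK ((fun κ u => comp (comp (trK (psiKS (ctrOff (d + 1) Lc) Lc)) (slotPsiS (ctrOff (d + 1) Lc) Lc (unitS sf sm (SpureCombOf (symTablesAn1S2 d Lc cΛt) cE cVH cΛ i)) κ u)) (psiKS (ctrOff (d + 1) Lc) Lc)) κ u) := by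
  rw [transport_unitS (ctrOff (d + 1) Lc) Lc sf sm (SpureCombOf (symTablesAn1S2 d Lc cΛt) cE cVH cΛ i)]
  exact trK_unitS_of_rows (fun κ u => parityOdd_transportS (d := d) (Lc := Lc) cΛt cE cVH cΛ i κ u) sf sm κ u

/-- NOT IN PRINT; OUR BOOKKEEPING.  Every row of the transported charge-vertex family of the an1 record is parity-odd (road-P2 `parityOdd_conj_psiKS` with an1's
`trK_M1Of_symHessFFAt` through `CombForcingPairForm.trK_unitM_tabs`). -/
theorem transported_rows_parityOdd_M (cΛt sf sm : ℝ) (i : ℕ) (ρ : Fin (d + 1)) (w : Site (d + 1)) :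
    trK ((fun ρ w => comp (comp (trK (psiKS (ctrOff (d + 1) Lc) Lc)) (unitM sf sm ((symTablesAn1S2 d Lc cΛt).M i) ρ w)) (psiKS (ctrOff (d + 1) Lc) Lc)) ρ w)
      = -sgnK ((fun ρ w => comp (comp (trK (psiKS (ctrOff (d + 1) Lc) Lc)) (unitM sf sm ((symTablesAn1S2 d Lc cΛt).M i) ρ w)) (psiKS (ctrOff (d + 1) Lc) Lc)) ρ w) := by
  have hLc : 0 < Lc := Nat.pos_of_ne_zero (NeZero.ne Lc)
  obtain ⟨CM, δM, hδM, hM⟩ := exists_vertexFamily_unitM_tabs (symTablesAn1S2 d Lc cΛt) sf sm i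
  exact parityOdd_conj_psiKS (spr_psiKS hLc (ctrOff_mem_box hLc)) ⟨_, _, _, _, hδM, hM ρ w⟩
    (trK_unitM_tabs (symTablesAn1S2 d Lc cΛt) (fun j ρ w => trK_M1Of_symHessFFAt (ctr (d + 1) Lc) cΛt j ρ w) sf sm i ρ w)

/-! ## §3 The valued crossed face read of the comb forcing at the deep levels -/

/-- NOT IN PRINT; OUR BOOKKEEPING.  **THE CROSSED PERIOD-`P` FACE READ OF THE COMB FORCING TABLE AT LEVEL `j+1`, VALUED** (`d`-generic; any border `B` vanishing on
the fine-fine block; any `a₀ ≠ b₀`; `1 ≤ P`).  The right-hand side is leaf-06's `FaceReadCrossedValueDeep.crossed_faceRead_dressedStep_deep` right-hand side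
token for token, so the OWNER's `d = 3` junction applies `FaceReadCrossedValueDeepPin.pin_deep_crossed` to it verbatim. -/
theorem crossed_faceRead_comb_deep (cΛt : ℝ) {P : ℕ} (hP : 1 ≤ P) (sf sm cΛ : ℝ) (j : ℕ)
    {B : Tab d} (hBff : ∀ κ u κ' u' x z (α β : Fin (d + 1)), B κ u κ' u' x z (Sum.inl α) (Sum.inl β) = 0) (c cB : ℝ)
    {a₀ b₀ : Fin (d + 1)} (hab : a₀ ≠ b₀) :
        ((fun μ ν α β : Fin (d + 1) => ∑ r' ∈ box (d + 1) P, ∑' u' : Site (d + 1), ∑' x : Site (d + 1), ∑' z : Site (d + 1),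
            (if toSite r' μ % (P : ℤ) = (P : ℤ) - 1 ∧ u' ν % (P : ℤ) = (P : ℤ) - 1 ∧ x α % (P : ℤ) = (P : ℤ) - 1 ∧ z β % (P : ℤ) = (P : ℤ) - 1 then
              ((fun κ u κ' u' => c • mmRead Lc (K3OfK (unitK sf sm (GcombSh (d := d) Lc (j + 1))) Lc (unitS sf sm (SpureCombOf (symTablesAn1S2 d Lc cΛt) ((Lc : ℝ) ^ (d + 1)) (-((Lc : ℝ) ^ (d + 1) * (1 / 2) * (Lc : ℝ) ^ (d + 1))) cΛ (j + 1))) (unitM sf sm ((symTablesAn1S2 d Lc cΛt).M (j + 1)))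
                  (W2SymOfK (unitK sf sm (GcombSh (d := d) Lc (j + 1))) Lc (unitS sf sm (SpureCombOf (symTablesAn1S2 d Lc cΛt) ((Lc : ℝ) ^ (d + 1)) (-((Lc : ℝ) ^ (d + 1) * (1 / 2) * (Lc : ℝ) ^ (d + 1))) cΛ (j + 1))) (unitM sf sm ((symTablesAn1S2 d Lc cΛt).M (j + 1))) 0
                    (unitM₂ sf sm (M2Of d Lc (symTablesAn1S2 d Lc cΛt).mixFF (j + 1)))) κ u κ' u') + cB • B κ u κ' u') μ (toSite r') ν u') x z (Sum.inl α) (Sum.inl β) else 0)) a₀ b₀ a₀ b₀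
          + (fun μ ν α β : Fin (d + 1) => ∑ r' ∈ box (d + 1) P, ∑' u' : Site (d + 1), ∑' x : Site (d + 1), ∑' z : Site (d + 1),
            (if toSite r' μ % (P : ℤ) = (P : ℤ) - 1 ∧ u' ν % (P : ℤ) = (P : ℤ) - 1 ∧ x α % (P : ℤ) = (P : ℤ) - 1 ∧ z β % (P : ℤ) = (P : ℤ) - 1 then
              ((fun κ u κ' u' => c • mmRead Lc (K3OfK (unitK sf sm (GcombSh (d := d) Lc (j + 1))) Lc (unitS sf sm (SpureCombOf (symTablesAn1S2 d Lc cΛt) ((Lc : ℝ) ^ (d + 1)) (-((Lc : ℝ) ^ (d + 1) * (1 / 2) * (Lc : ℝ) ^ (d + 1))) cΛ (j + 1))) (unitM sf sm ((symTablesAn1S2 d Lc cΛt).M (j + 1)))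
                  (W2SymOfK (unitK sf sm (GcombSh (d := d) Lc (j + 1))) Lc (unitS sf sm (SpureCombOf (symTablesAn1S2 d Lc cΛt) ((Lc : ℝ) ^ (d + 1)) (-((Lc : ℝ) ^ (d + 1) * (1 / 2) * (Lc : ℝ) ^ (d + 1))) cΛ (j + 1))) (unitM sf sm ((symTablesAn1S2 d Lc cΛt).M (j + 1))) 0
                    (unitM₂ sf sm (M2Of d Lc (symTablesAn1S2 d Lc cΛt).mixFF (j + 1)))) κ u κ' u') + cB • B κ u κ' u') μ (toSite r') ν u') x z (Sum.inl α) (Sum.inl β) else 0)) b₀ a₀ a₀ b₀)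
        + ((fun μ ν α β : Fin (d + 1) => ∑ r' ∈ box (d + 1) P, ∑' u' : Site (d + 1), ∑' x : Site (d + 1), ∑' z : Site (d + 1),
            (if toSite r' μ % (P : ℤ) = (P : ℤ) - 1 ∧ u' ν % (P : ℤ) = (P : ℤ) - 1 ∧ x α % (P : ℤ) = (P : ℤ) - 1 ∧ z β % (P : ℤ) = (P : ℤ) - 1 then
              ((fun κ u κ' u' => c • mmRead Lc (K3OfK (unitK sf sm (GcombSh (d := d) Lc (j + 1))) Lc (unitS sf sm (SpureCombOf (symTablesAn1S2 d Lc cΛt) ((Lc : ℝ) ^ (d + 1)) (-((Lc : ℝ) ^ (d + 1) * (1 / 2) * (Lc : ℝ) ^ (d + 1))) cΛ (j + 1))) (unitM sf sm ((symTablesAn1S2 d Lc cΛt).M (j + 1)))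
                  (W2SymOfK (unitK sf sm (GcombSh (d := d) Lc (j + 1))) Lc (unitS sf sm (SpureCombOf (symTablesAn1S2 d Lc cΛt) ((Lc : ℝ) ^ (d + 1)) (-((Lc : ℝ) ^ (d + 1) * (1 / 2) * (Lc : ℝ) ^ (d + 1))) cΛ (j + 1))) (unitM sf sm ((symTablesAn1S2 d Lc cΛt).M (j + 1))) 0
                    (unitM₂ sf sm (M2Of d Lc (symTablesAn1S2 d Lc cΛt).mixFF (j + 1)))) κ u κ' u') + cB • B κ u κ' u') μ (toSite r') ν u') x z (Sum.inl α) (Sum.inl β) else 0)) b₀ a₀ a₀ b₀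
          + (fun μ ν α β : Fin (d + 1) => ∑ r' ∈ box (d + 1) P, ∑' u' : Site (d + 1), ∑' x : Site (d + 1), ∑' z : Site (d + 1),
            (if toSite r' μ % (P : ℤ) = (P : ℤ) - 1 ∧ u' ν % (P : ℤ) = (P : ℤ) - 1 ∧ x α % (P : ℤ) = (P : ℤ) - 1 ∧ z β % (P : ℤ) = (P : ℤ) - 1 then
              ((fun κ u κ' u' => c • mmRead Lc (K3OfK (unitK sf sm (GcombSh (d := d) Lc (j + 1))) Lc (unitS sf sm (SpureCombOf (symTablesAn1S2 d Lc cΛt) ((Lc : ℝ) ^ (d + 1)) (-((Lc : ℝ) ^ (d + 1) * (1 / 2) * (Lc : ℝ) ^ (d + 1))) cΛ (j + 1))) (unitM sf sm ((symTablesAn1S2 d Lc cΛt).M (j + 1)))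
                  (W2SymOfK (unitK sf sm (GcombSh (d := d) Lc (j + 1))) Lc (unitS sf sm (SpureCombOf (symTablesAn1S2 d Lc cΛt) ((Lc : ℝ) ^ (d + 1)) (-((Lc : ℝ) ^ (d + 1) * (1 / 2) * (Lc : ℝ) ^ (d + 1))) cΛ (j + 1))) (unitM sf sm ((symTablesAn1S2 d Lc cΛt).M (j + 1))) 0
                    (unitM₂ sf sm (M2Of d Lc (symTablesAn1S2 d Lc cΛt).mixFF (j + 1)))) κ u κ' u') + cB • B κ u κ' u') μ (toSite r') ν u') x z (Sum.inl α) (Sum.inl β) else 0)) a₀ b₀ a₀ b₀)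
        + (((fun μ ν α β : Fin (d + 1) => ∑ r' ∈ box (d + 1) P, ∑' u' : Site (d + 1), ∑' x : Site (d + 1), ∑' z : Site (d + 1),
            (if toSite r' μ % (P : ℤ) = (P : ℤ) - 1 ∧ u' ν % (P : ℤ) = (P : ℤ) - 1 ∧ x α % (P : ℤ) = (P : ℤ) - 1 ∧ z β % (P : ℤ) = (P : ℤ) - 1 then
              ((fun κ u κ' u' => c • mmRead Lc (K3OfK (unitK sf sm (GcombSh (d := d) Lc (j + 1))) Lc (unitS sf sm (SpureCombOf (symTablesAn1S2 d Lc cΛt) ((Lc : ℝ) ^ (d + 1)) (-((Lc : ℝ) ^ (d + 1) * (1 / 2) * (Lc : ℝ) ^ (d + 1))) cΛ (j + 1))) (unitM sf sm ((symTablesAn1S2 d Lc cΛt).M (j + 1)))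
                  (W2SymOfK (unitK sf sm (GcombSh (d := d) Lc (j + 1))) Lc (unitS sf sm (SpureCombOf (symTablesAn1S2 d Lc cΛt) ((Lc : ℝ) ^ (d + 1)) (-((Lc : ℝ) ^ (d + 1) * (1 / 2) * (Lc : ℝ) ^ (d + 1))) cΛ (j + 1))) (unitM sf sm ((symTablesAn1S2 d Lc cΛt).M (j + 1))) 0
                    (unitM₂ sf sm (M2Of d Lc (symTablesAn1S2 d Lc cΛt).mixFF (j + 1)))) κ u κ' u') + cB • B κ u κ' u') μ (toSite r') ν u') x z (Sum.inl α) (Sum.inl β) else 0)) a₀ b₀ b₀ a₀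
          + (fun μ ν α β : Fin (d + 1) => ∑ r' ∈ box (d + 1) P, ∑' u' : Site (d + 1), ∑' x : Site (d + 1), ∑' z : Site (d + 1),
            (if toSite r' μ % (P : ℤ) = (P : ℤ) - 1 ∧ u' ν % (P : ℤ) = (P : ℤ) - 1 ∧ x α % (P : ℤ) = (P : ℤ) - 1 ∧ z β % (P : ℤ) = (P : ℤ) - 1 then
              ((fun κ u κ' u' => c • mmRead Lc (K3OfK (unitK sf sm (GcombSh (d := d) Lc (j + 1))) Lc (unitS sf sm (SpureCombOf (symTablesAn1S2 d Lc cΛt) ((Lc : ℝ) ^ (d + 1)) (-((Lc : ℝ) ^ (d + 1) * (1 / 2) * (Lc : ℝ) ^ (d + 1))) cΛ (j + 1))) (unitM sf sm ((symTablesAn1S2 d Lc cΛt).M (j + 1)))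
                  (W2SymOfK (unitK sf sm (GcombSh (d := d) Lc (j + 1))) Lc (unitS sf sm (SpureCombOf (symTablesAn1S2 d Lc cΛt) ((Lc : ℝ) ^ (d + 1)) (-((Lc : ℝ) ^ (d + 1) * (1 / 2) * (Lc : ℝ) ^ (d + 1))) cΛ (j + 1))) (unitM sf sm ((symTablesAn1S2 d Lc cΛt).M (j + 1))) 0
                    (unitM₂ sf sm (M2Of d Lc (symTablesAn1S2 d Lc cΛt).mixFF (j + 1)))) κ u κ' u') + cB • B κ u κ' u') μ (toSite r') ν u') x z (Sum.inl α) (Sum.inl β) else 0)) b₀ a₀ b₀ a₀)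
        + ((fun μ ν α β : Fin (d + 1) => ∑ r' ∈ box (d + 1) P, ∑' u' : Site (d + 1), ∑' x : Site (d + 1), ∑' z : Site (d + 1),
            (if toSite r' μ % (P : ℤ) = (P : ℤ) - 1 ∧ u' ν % (P : ℤ) = (P : ℤ) - 1 ∧ x α % (P : ℤ) = (P : ℤ) - 1 ∧ z β % (P : ℤ) = (P : ℤ) - 1 then
              ((fun κ u κ' u' => c • mmRead Lc (K3OfK (unitK sf sm (GcombSh (d := d) Lc (j + 1))) Lc (unitS sf sm (SpureCombOf (symTablesAn1S2 d Lc cΛt) ((Lc : ℝ) ^ (d + 1)) (-((Lc : ℝ) ^ (d + 1) * (1 / 2) * (Lc : ℝ) ^ (d + 1))) cΛ (j + 1))) (unitM sf sm ((symTablesAn1S2 d Lc cΛt).M (j + 1)))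
                  (W2SymOfK (unitK sf sm (GcombSh (d := d) Lc (j + 1))) Lc (unitS sf sm (SpureCombOf (symTablesAn1S2 d Lc cΛt) ((Lc : ℝ) ^ (d + 1)) (-((Lc : ℝ) ^ (d + 1) * (1 / 2) * (Lc : ℝ) ^ (d + 1))) cΛ (j + 1))) (unitM sf sm ((symTablesAn1S2 d Lc cΛt).M (j + 1))) 0
                    (unitM₂ sf sm (M2Of d Lc (symTablesAn1S2 d Lc cΛt).mixFF (j + 1)))) κ u κ' u') + cB • B κ u κ' u') μ (toSite r') ν u') x z (Sum.inl α) (Sum.inl β) else 0)) b₀ a₀ b₀ a₀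
          + (fun μ ν α β : Fin (d + 1) => ∑ r' ∈ box (d + 1) P, ∑' u' : Site (d + 1), ∑' x : Site (d + 1), ∑' z : Site (d + 1),
            (if toSite r' μ % (P : ℤ) = (P : ℤ) - 1 ∧ u' ν % (P : ℤ) = (P : ℤ) - 1 ∧ x α % (P : ℤ) = (P : ℤ) - 1 ∧ z β % (P : ℤ) = (P : ℤ) - 1 then
              ((fun κ u κ' u' => c • mmRead Lc (K3OfK (unitK sf sm (GcombSh (d := d) Lc (j + 1))) Lc (unitS sf sm (SpureCombOf (symTablesAn1S2 d Lc cΛt) ((Lc : ℝ) ^ (d + 1)) (-((Lc : ℝ) ^ (d + 1) * (1 / 2) * (Lc : ℝ) ^ (d + 1))) cΛ (j + 1))) (unitM sf sm ((symTablesAn1S2 d Lc cΛt).M (j + 1)))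
                  (W2SymOfK (unitK sf sm (GcombSh (d := d) Lc (j + 1))) Lc (unitS sf sm (SpureCombOf (symTablesAn1S2 d Lc cΛt) ((Lc : ℝ) ^ (d + 1)) (-((Lc : ℝ) ^ (d + 1) * (1 / 2) * (Lc : ℝ) ^ (d + 1))) cΛ (j + 1))) (unitM sf sm ((symTablesAn1S2 d Lc cΛt).M (j + 1))) 0
                    (unitM₂ sf sm (M2Of d Lc (symTablesAn1S2 d Lc cΛt).mixFF (j + 1)))) κ u κ' u') + cB • B κ u κ' u') μ (toSite r') ν u') x z (Sum.inl α) (Sum.inl β) else 0)) a₀ b₀ b₀ a₀))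
          = 4 * ((c * -(((sf * sm) * (stepScale d Lc (j + 1) * (Lc : ℝ) ^ (d + 1))⁻¹) * ((sf * sm) * (stepScale d Lc (j + 1) * (Lc : ℝ) ^ (d + 1))⁻¹))) * (((sf * sm) * (stepScale d Lc (j + 1) * (Lc : ℝ) ^ (d + 1))⁻¹) * ((sf * sm) * (stepScale d Lc (j + 1) * (Lc : ℝ) ^ (d + 1))⁻¹))) *
            ((((sf * sm)⁻¹ * (sf⁻¹ * sf⁻¹) * ((Lc : ℝ) ^ (d + 1) * wE d Lc (j + 1))) * ((sf * sm)⁻¹ * (sf⁻¹ * sf⁻¹) * ((Lc : ℝ) ^ (d + 1) * wE d Lc (j + 1)))) *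
      ((-(1 / 2 : ℝ)) * (1 / 2 : ℝ) * ((sf * sf) *
        ((wVH d Lc (j + 1))⁻¹ *
            ∑ x ∈ box (d + 1) (Lc * P), ∑ b : Fin (d + 1),
              ((if b = b₀ then ((((Lc * P : ℕ) : ℝ))⁻¹ * (((Lc * P : ℕ) : ℝ))⁻¹) * ((((toSite x a₀ % ((Lc * P : ℕ) : ℤ) : ℤ) : ℝ) - ((((Lc * P : ℕ) : ℝ)) - 1) / 2)) else 0)
                + (if b = a₀ then (-(((Lc * P : ℕ) : ℝ))⁻¹ * ((((toSite x b₀ % ((Lc * P : ℕ) : ℤ) : ℤ) : ℝ) - ((((Lc * P : ℕ) : ℝ)) - 1) / 2))) *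
                    (if toSite x a₀ % ((Lc * P : ℕ) : ℤ) = ((Lc * P : ℕ) : ℤ) - 1 then (1 : ℝ) else 0) else 0)) *
              ∑' s : Site (d + 1), ∑ b' : Fin (d + 1), E2 d Lc (j + 1) (toSite x) s (Sum.inl b) (Sum.inl b') *
                ((if b' = a₀ then ((((Lc * P : ℕ) : ℝ))⁻¹ * (((Lc * P : ℕ) : ℝ))⁻¹) * ((((s b₀ % ((Lc * P : ℕ) : ℤ) : ℤ) : ℝ) - ((((Lc * P : ℕ) : ℝ)) - 1) / 2)) else 0)
                  + (if b' = b₀ then (-(((Lc * P : ℕ) : ℝ))⁻¹ * ((((s a₀ % ((Lc * P : ℕ) : ℤ) : ℤ) : ℝ) - ((((Lc * P : ℕ) : ℝ)) - 1) / 2))) *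
                      (if s b₀ % ((Lc * P : ℕ) : ℤ) = ((Lc * P : ℕ) : ℤ) - 1 then (1 : ℝ) else 0) else 0)) -
          (wVH d Lc (j + 1))⁻¹ * (((Lc : ℝ) ^ (d + 1) * (Lc : ℝ) ^ (d + 1)) *
            ∑ y ∈ box (d + 1) P, ∑ a : Fin (d + 1),
              ((if a = b₀ then (((P : ℝ))⁻¹ * ((P : ℝ))⁻¹) * ((((toSite y a₀ % (P : ℤ)) : ℤ) : ℝ) - ((P : ℝ) - 1) / 2) else 0)
                + (if a = a₀ then (-((P : ℝ))⁻¹ * ((((toSite y b₀ % (P : ℤ)) : ℤ) : ℝ) - ((P : ℝ) - 1) / 2)) *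
                    (if toSite y a₀ % (P : ℤ) = (P : ℤ) - 1 then (1 : ℝ) else 0) else 0)) *
              ∑' s : Site (d + 1), ∑ b' : Fin (d + 1), E2 d Lc (j + 2) (toSite y) s (Sum.inl a) (Sum.inl b') *
                ((if b' = a₀ then (((P : ℝ))⁻¹ * ((P : ℝ))⁻¹) * ((((s b₀ % (P : ℤ)) : ℤ) : ℝ) - ((P : ℝ) - 1) / 2) else 0)
                  + (if b' = b₀ then (-((P : ℝ))⁻¹ * ((((s a₀ % (P : ℤ)) : ℤ) : ℝ) - ((P : ℝ) - 1) / 2)) *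
                      (if s b₀ % (P : ℤ) = (P : ℤ) - 1 then (1 : ℝ) else 0) else 0))))))
            + (((sf * sm)⁻¹ * (sf⁻¹ * sf⁻¹) * ((Lc : ℝ) ^ (d + 1) * wE d Lc (j + 1))) * ((sf * sm)⁻¹ * (sf⁻¹ * sf⁻¹) * ((Lc : ℝ) ^ (d + 1) * wE d Lc (j + 1)))) *
      ((-(1 / 2 : ℝ)) * (1 / 2 : ℝ) * ((sf * sf) *
        ((wVH d Lc (j + 1))⁻¹ *
            ∑ x ∈ box (d + 1) (Lc * P), ∑ b : Fin (d + 1),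
              ((if b = a₀ then ((((Lc * P : ℕ) : ℝ))⁻¹ * (((Lc * P : ℕ) : ℝ))⁻¹) * ((((toSite x b₀ % ((Lc * P : ℕ) : ℤ) : ℤ) : ℝ) - ((((Lc * P : ℕ) : ℝ)) - 1) / 2)) else 0)
                + (if b = b₀ then (-(((Lc * P : ℕ) : ℝ))⁻¹ * ((((toSite x a₀ % ((Lc * P : ℕ) : ℤ) : ℤ) : ℝ) - ((((Lc * P : ℕ) : ℝ)) - 1) / 2))) *
                    (if toSite x b₀ % ((Lc * P : ℕ) : ℤ) = ((Lc * P : ℕ) : ℤ) - 1 then (1 : ℝ) else 0) else 0)) *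
              ∑' s : Site (d + 1), ∑ b' : Fin (d + 1), E2 d Lc (j + 1) (toSite x) s (Sum.inl b) (Sum.inl b') *
                ((if b' = b₀ then ((((Lc * P : ℕ) : ℝ))⁻¹ * (((Lc * P : ℕ) : ℝ))⁻¹) * ((((s a₀ % ((Lc * P : ℕ) : ℤ) : ℤ) : ℝ) - ((((Lc * P : ℕ) : ℝ)) - 1) / 2)) else 0)
                  + (if b' = a₀ then (-(((Lc * P : ℕ) : ℝ))⁻¹ * ((((s b₀ % ((Lc * P : ℕ) : ℤ) : ℤ) : ℝ) - ((((Lc * P : ℕ) : ℝ)) - 1) / 2))) *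
                      (if s a₀ % ((Lc * P : ℕ) : ℤ) = ((Lc * P : ℕ) : ℤ) - 1 then (1 : ℝ) else 0) else 0)) -
          (wVH d Lc (j + 1))⁻¹ * (((Lc : ℝ) ^ (d + 1) * (Lc : ℝ) ^ (d + 1)) *
            ∑ y ∈ box (d + 1) P, ∑ a : Fin (d + 1),
              ((if a = a₀ then (((P : ℝ))⁻¹ * ((P : ℝ))⁻¹) * ((((toSite y b₀ % (P : ℤ)) : ℤ) : ℝ) - ((P : ℝ) - 1) / 2) else 0)
                + (if a = b₀ then (-((P : ℝ))⁻¹ * ((((toSite y a₀ % (P : ℤ)) : ℤ) : ℝ) - ((P : ℝ) - 1) / 2)) *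
                    (if toSite y b₀ % (P : ℤ) = (P : ℤ) - 1 then (1 : ℝ) else 0) else 0)) *
              ∑' s : Site (d + 1), ∑ b' : Fin (d + 1), E2 d Lc (j + 2) (toSite y) s (Sum.inl a) (Sum.inl b') *
                ((if b' = b₀ then (((P : ℝ))⁻¹ * ((P : ℝ))⁻¹) * ((((s a₀ % (P : ℤ)) : ℤ) : ℝ) - ((P : ℝ) - 1) / 2) else 0)
                  + (if b' = a₀ then (-((P : ℝ))⁻¹ * ((((s b₀ % (P : ℤ)) : ℤ) : ℝ) - ((P : ℝ) - 1) / 2)) *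
                      (if s a₀ % (P : ℤ) = (P : ℤ) - 1 then (1 : ℝ) else 0) else 0)))))))  := by
  classical
  haveI : NeZero P := ⟨by omega⟩
  have hLc1 : 1 ≤ Lc := one_le_of_neZero Lc
  have hLc : 0 < Lc := hLc1
  have hr : ctrOff (d + 1) Lc ∈ box (d + 1) Lc := ctrOff_mem_box hLc
  obtain ⟨Cs, δs, hδs, hS⟩ := exists_locStencil_transport_S (symTablesAn1S2 d Lc cΛt) sf sm ((Lc : ℝ) ^ (d + 1)) (-((Lc : ℝ) ^ (d + 1) * (1 / 2) * (Lc : ℝ) ^ (d + 1))) cΛ (j + 1)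
  obtain ⟨CM, δM, hδM, hM⟩ := exists_vertexFamily_transport_M (symTablesAn1S2 d Lc cΛt) sf sm (j + 1)
  obtain ⟨C₂, δ₂, hδ₂, hM₂⟩ := exists_locStencilFM_transport_M₂ (symTablesAn1S2 d Lc cΛt) sf sm (j + 1)
  have key := crossed_faceRead_of_values (d := d) hLc1 hr hP sf sm (j + 1) hS hδs hM hδM
    (fun κ u t => transportS_unitS_translate (symTablesAn1S2 d Lc cΛt) sf sm ((Lc : ℝ) ^ (d + 1)) (-((Lc : ℝ) ^ (d + 1) * (1 / 2) * (Lc : ℝ) ^ (d + 1))) cΛ (j + 1) κ u t)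
    (fun ρ w t => transportM_translate (symTablesAn1S2 d Lc cΛt) sf sm (j + 1) ρ w t)
    (fun κ u => transported_rows_parityOdd_S (d := d) (Lc := Lc) cΛt sf sm ((Lc : ℝ) ^ (d + 1)) (-((Lc : ℝ) ^ (d + 1) * (1 / 2) * (Lc : ℝ) ^ (d + 1))) cΛ (j + 1) κ u)
    (fun ρ w => transported_rows_parityOdd_M (d := d) (Lc := Lc) cΛt sf sm (j + 1) ρ w)
    hM₂ hδ₂ (fun κ u ρ w t => transportM₂_translate (symTablesAn1S2 d Lc cΛt) sf sm (j + 1) κ u ρ w t) hBff c cB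
    (combWord_deep_value (d := d) cΛt sf sm cΛ j P hab.symm hab)
    (combWord_deep_value (d := d) cΛt sf sm cΛ j P hab hab.symm)
    (combWord_deep_eq_zero_of_left_diag (d := d) cΛt sf sm cΛ j P a₀ b₀ b₀)
    (combWord_deep_eq_zero_of_left_diag (d := d) cΛt sf sm cΛ j P b₀ a₀ a₀)
    (combSwapWord_deep_value (d := d) cΛt sf sm cΛ j P hab.symm hab)
    (combSwapWord_deep_value (d := d) cΛt sf sm cΛ j P hab hab.symm)
    (combSwapWord_deep_eq_zero_of_left_diag (d := d) cΛt sf sm cΛ j P b₀ a₀ b₀)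
    (combSwapWord_deep_eq_zero_of_left_diag (d := d) cΛt sf sm cΛ j P a₀ b₀ a₀)
  rw [combForcingTable_eq_bm_transport]
  beta_reduce
  exact key

end Summit.QuantumFields.BalabanUV.Beta.GAN24.CombFaceReadCrossedValueDeep

end
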